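import Summits.QuantumFields.YangMills.Theorems.BalabanLadderNTPointwiseFloor
import Summits.QuantumFields.YangMills.Theorems.BalabanLadderNTCeilingPriceThreePoint
import HarnessLib

/-!
# Crux `NT` (stmt-QuantumFields-19353), stub `stub_refpkgT : RefPkgT`: THE ASYMPTOTIC-FREEDOM COLLAR LAW — a pointwise
# two-point tolerance `W` at the witness scale and the registered clause 4 force `2C₁²(2δ/κ)⁸ < W` (spacing-free, `ε`-free)

Helper file (`--supports stmt-QuantumFields-19353`) of the fleet lead prover of crux `NT` (unit `ym-spine-19353-p1`, GEN 13);
sequel of `…NTPointwiseFloor` (charged pairs of the reflection witness sit at lattice distance `n ≥ 2δ/s`) and of GEN 12's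
`…NTCeilingPricePackage` (collar law `δ ≤ 2^{1/8}κ` from the clause-1 CAP).  Hypothesis-free, general compact `G`, any `r`;
everything at ONE coupling on ONE torus.

Here the clause-1 cap is replaced by a POINTWISE TOLERANCE at the witness scale — the currency of the IR desk's asymptotic-freedom
window (`SharpLanes.CovWindowAt`: `(1+n)⁸|Cov_T(A_x,A_y)| ≤ W` below a scale) — read on the pairs charged by `θv, v` (all at
lattice distance `n ≥ 2δ/s`): if `n⁸·|Cov_T(A_x, A_y)| ≤ W` on those pairs, then
`ε + 2C₁²(s/κ)⁸S_θS_v ≤ Q2(θv,v) ≤ S_θS_v·W·(s/2δ)⁸`, and with the SAME `S_θS_v` on both sides the spacing cancels EXACTLY: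

* `two_mul_sq_lt_of_window`, `two_mul_cube_lt_of_window` — window arithmetic;
* `abs_Q2_le_of_tolerance`, `abs_Q3_le_of_tolerance₃` — the pointwise tolerances as caps on the smeared functions
  (`|Q2(θv,v)| ≤ S_θS_v·W(s/2δ)⁸`, `|Q3(f,g,h)| ≤ S_fS_gS_h·W₃(s/δ')¹²`);
* **`two_mul_sq_lt_tolerance_of_clause4_at`** — **`2C₁²(2δ)⁸ < W·κ⁸`**: the two-point tolerance at the witness scale must exceed
  `2C₁²(2δ/κ)⁸`, i.e. `δ < (κ/2)(W/2C₁²)^{1/8}`;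
* **`two_mul_cube_lt_tolerance₃_of_clause5_at`** — the clause-5 twin: a pointwise three-point tolerance `m¹²·|κ₃,T(x,y,z)| ≤ W₃`
  (`m` = least pairwise lattice separation) on the triples charged by `f, g, h` (pairwise support separation `δ'`) forces
  **`2C₁³δ'¹² < W₃·κ¹²`**.

With GEN 13's corner price `C₁ ≥ D = 6(N − Re tr ρ(g))` (`…NTCornerPrice`) these read `2D²(2δ/κ)⁸ < W`, `2D³(δ'/κ)¹² < W₃`
(sequel file).  READING (memo SIZING-19353-g13 §2): asymptotic freedom says the dimensionless amplitude `W` at physical scale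
`2δ…2σ` is `≍ ḡ⁴` (small in the femto regime); the law pins the witness INSIDE the collar by the factor `(W/2C₁²)^{1/8}/2`;
conversely a package instance REFUTES an AF window of tolerance `≤ 2C₁²(2δ/κ)⁸` reaching its own witness scale (the IR desk's
pincer `AfPincerUc.afBelowScale_of_covarianceAF`, made `ε`-free and quantitative).

HONEST FRAMING.  Real arithmetic over tree theorems; CONDITIONAL on the registered clause 4/5 inequality and on the pointwise
tolerance; no floor, not AF, not NT, not the seam, not the gap; not Clay.
-/

set_option autoImplicit false

noncomputable section

open scoped SchwartzMap
open MeasureTheory Filter Topology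
open Literature.MathematicalPhysics.QuantumFieldTheory Literature.MathematicalPhysics.QuantumLattice
open Literature.Probability.LatticeModels
open Summit.QuantumFields.YangMills.Cruxes.OSLegsFromFemtoAndGap.DlrCollarTransfer
open Summit.QuantumFields.YangMills.Cruxes.NT.Reference (sep_le_mul_norm)

namespace Summit.QuantumFields.YangMills.Cruxes.NT.AFCollar

/-! ## §1 Window arithmetic -/

/-- **Two-point window arithmetic.**  `ε + 2(C₁tS)(C₁tS') ≤ X ≤ S S'·B`, `ε > 0`, `S, S' ≥ 0` ⇒ `2C₁²t² < B`. [folklore] -/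
theorem two_mul_sq_lt_of_window {ε C₁ t S S' X B : ℝ} (hε : 0 < ε) (hS : 0 ≤ S) (hS' : 0 ≤ S')
    (hfloor : ε + 2 * (C₁ * t * S) * (C₁ * t * S') ≤ X) (hcap : X ≤ S * S' * B) : 2 * C₁ ^ 2 * t ^ 2 < B := by
  have hwin : S * S' * (2 * C₁ ^ 2 * t ^ 2) < S * S' * B := by nlinarith
  have hP : 0 < S * S' := by
    rcases (mul_nonneg hS hS').lt_or_eq with h | h
    · exact h
    · exfalso; rw [← h] at hwin; simp at hwin
  exact lt_of_mul_lt_mul_left hwin hP.le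

/-- **Three-point window arithmetic.**  `ε + 2(C₁t)³·P ≤ X ≤ P·B`, `ε > 0`, `P ≥ 0` ⇒ `2C₁³t³ < B`. [folklore] -/
theorem two_mul_cube_lt_of_window {ε C₁ t P X B : ℝ} (hε : 0 < ε) (hP : 0 ≤ P)
    (hfloor : ε + 2 * (C₁ * t) ^ 3 * P ≤ X) (hcap : X ≤ P * B) : 2 * C₁ ^ 3 * t ^ 3 < B := by
  have hwin : P * (2 * C₁ ^ 3 * t ^ 3) < P * B := by nlinarith
  have hP' : 0 < P := by
    rcases hP.lt_or_eq with h | h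
    · exact h
    · exfalso; rw [← h] at hwin; simp at hwin
  exact lt_of_mul_lt_mul_left hwin hP'.le

/-! ## §2 Pointwise tolerances as caps on the smeared functions -/

section Caps

variable (G : Type) [Group G] [TopologicalSpace G] [IsTopologicalGroup G] [CompactSpace G]
  [MeasurableSpace G] [BorelSpace G] (r : LatticeRep G)

/-- **Two-point tolerance ⇒ cap.**  If `v` has time gap `δ > 0` (`s > 0`) and `‖y−x‖⁸·|Cov_T(A_x,A_y)| ≤ W` on the pairs
charged by `θv, v`, then `|Q2_{β,L,s}(θv, v)| ≤ S_θS_v · W(s/2δ)⁸`. [folklore] -/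
theorem abs_Q2_le_of_tolerance (β : ℝ) {s W : ℝ} (hs : 0 < s) {v : 𝓢(EuclideanSpace ℝ (Fin 4), ℝ)} {δ : ℝ} (hδ : 0 < δ)
    (hvδ : ∀ y : EuclideanSpace ℝ (Fin 4), v y ≠ 0 → δ ≤ y 0) {L : ℕ}
    (hW : ∀ x ∈ box 4 L, ∀ y ∈ box 4 L, thetaTest 4 v (s • siteToE x) ≠ 0 → v (s • siteToE y) ≠ 0 →
      ‖siteToE (y - x)‖ ^ 8 * |torusE G r β L (fun U => dens G r x U * dens G r y U) -
        torusE G r β L (dens G r x) * torusE G r β L (dens G r y)| ≤ W) :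
    |Q2 G r β L s (thetaTest 4 v) v| ≤
      (∑ x ∈ box 4 L, |thetaTest 4 v (s • siteToE x)|) * (∑ y ∈ box 4 L, |v (s • siteToE y)|) * (W * (s / (2 * δ)) ^ 8) := by
  refine CeilingPrice.abs_Q2_le_of_pointwise G r β L s (thetaTest 4 v) v fun x hx y hy hfx hgy => ?_
  obtain ⟨-, hgap⟩ := PointwiseFloor.two_mul_timeGap_le_of_charged hs.le hvδ hfx hgy
  have hn : 2 * δ / s ≤ ‖siteToE (y - x)‖ := by
    rw [div_le_iff₀ hs]
    calc 2 * δ ≤ s * ‖siteToE (y - x)‖ := hgap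
      _ = ‖siteToE (y - x)‖ * s := mul_comm _ _
  have hn0 : 0 < ‖siteToE (y - x)‖ := lt_of_lt_of_le (by positivity) hn
  have h := hW x hx y hy hfx hgy
  have hW0 : 0 ≤ W := le_trans (by positivity) h
  calc |torusE G r β L (fun U => dens G r x U * dens G r y U) - torusE G r β L (dens G r x) * torusE G r β L (dens G r y)|
      ≤ W / ‖siteToE (y - x)‖ ^ 8 := by rw [le_div_iff₀ (pow_pos hn0 8), mul_comm]; exact h
    _ ≤ W / (2 * δ / s) ^ 8 := div_le_div_of_nonneg_left hW0 (by positivity) (pow_le_pow_left₀ (by positivity) hn 8)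
    _ = W * (s / (2 * δ)) ^ 8 := by rw [div_pow, div_pow, div_div_eq_mul_div, mul_div_assoc]

/-- **Three-point tolerance ⇒ cap.**  If `f, g, h` have pairwise support separation `δ' > 0` (`s > 0`) and
`m¹²·|κ₃,T(x,y,z)| ≤ W₃` on the charged triples (`m` the least pairwise lattice separation), then
`|Q3_{β,L,s}(f,g,h)| ≤ S_fS_gS_h · W₃(s/δ')¹²`. [folklore] -/
theorem abs_Q3_le_of_tolerance₃ (β : ℝ) {s W₃ : ℝ} (hs : 0 < s) {f g h : 𝓢(EuclideanSpace ℝ (Fin 4), ℝ)} {δ' : ℝ}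
    (hδ' : 0 < δ')
    (hfg : ∀ p q : EuclideanSpace ℝ (Fin 4), f p ≠ 0 → g q ≠ 0 → δ' ≤ ‖p - q‖)
    (hgh : ∀ p q : EuclideanSpace ℝ (Fin 4), g p ≠ 0 → h q ≠ 0 → δ' ≤ ‖p - q‖)
    (hfh : ∀ p q : EuclideanSpace ℝ (Fin 4), f p ≠ 0 → h q ≠ 0 → δ' ≤ ‖p - q‖) {L : ℕ}
    (hW : ∀ x ∈ box 4 L, ∀ y ∈ box 4 L, ∀ z ∈ box 4 L, f (s • siteToE x) ≠ 0 → g (s • siteToE y) ≠ 0 →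
      h (s • siteToE z) ≠ 0 →
        (min (min ‖siteToE (y - x)‖ ‖siteToE (z - y)‖) ‖siteToE (z - x)‖) ^ 12 * |torusK3 G r β L x y z| ≤ W₃) :
    |Q3 G r β L s f g h| ≤
      (∑ x ∈ box 4 L, |f (s • siteToE x)|) * (∑ y ∈ box 4 L, |g (s • siteToE y)|) *
        (∑ z ∈ box 4 L, |h (s • siteToE z)|) * (W₃ * (s / δ') ^ 12) := by
  refine CeilingPrice.abs_Q3_le_of_pointwise G r β L s f g h fun x hx y hy z hz hfx hgy hhz => ?_
  have h1 := (sep_le_mul_norm hfg hs hfx hgy).1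
  have h2 := (sep_le_mul_norm hgh hs hgy hhz).1
  have h3 := (sep_le_mul_norm hfh hs hfx hhz).1
  set m := min (min ‖siteToE (y - x)‖ ‖siteToE (z - y)‖) ‖siteToE (z - x)‖ with hm
  have hdiv : ∀ {u : ℝ}, δ' ≤ s * u → δ' / s ≤ u := fun {u} hu => by
    rw [div_le_iff₀ hs]
    calc δ' ≤ s * u := hu
      _ = u * s := mul_comm _ _
  have hmn : δ' / s ≤ m := le_min (le_min (hdiv h1) (hdiv h2)) (hdiv h3)
  have hm0 : 0 < m := lt_of_lt_of_le (by positivity) hmn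
  have hw := hW x hx y hy z hz hfx hgy hhz
  have hW0 : 0 ≤ W₃ := le_trans (by positivity) hw
  calc |torusK3 G r β L x y z| ≤ W₃ / m ^ 12 := by rw [le_div_iff₀ (pow_pos hm0 12), mul_comm]; exact hw
    _ ≤ W₃ / (δ' / s) ^ 12 := div_le_div_of_nonneg_left hW0 (by positivity) (pow_le_pow_left₀ (by positivity) hmn 12)
    _ = W₃ * (s / δ') ^ 12 := by rw [div_pow, div_pow, div_div_eq_mul_div, mul_div_assoc]

end Caps

/-! ## §3 The asymptotic-freedom collar laws -/

section Laws

variable (G : Type) [Group G] [TopologicalSpace G] [IsTopologicalGroup G] [CompactSpace G]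
  [MeasurableSpace G] [BorelSpace G] (r : LatticeRep G)

/-- Unit algebra: `2C²(s/κ)⁸ < W(s/2δ)⁸` ⇒ `2C²(2δ)⁸ < Wκ⁸`. [folklore] -/
theorem law₂_of_scaled {C s κ δ W : ℝ} (hs : 0 < s) (hκ : 0 < κ) (hδ : 0 < δ)
    (h : 2 * C ^ 2 * ((s / κ) ^ 4) ^ 2 < W * (s / (2 * δ)) ^ 8) : 2 * C ^ 2 * (2 * δ) ^ 8 < W * κ ^ 8 := by
  have e1 : 2 * C ^ 2 * ((s / κ) ^ 4) ^ 2 = 2 * C ^ 2 / κ ^ 8 * s ^ 8 := by rw [← pow_mul, div_pow]; ring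
  have e2 : W * (s / (2 * δ)) ^ 8 = W / (2 * δ) ^ 8 * s ^ 8 := by rw [div_pow]; ring
  rw [e1, e2] at h
  have h2 := lt_of_mul_lt_mul_right h (by positivity)
  rwa [div_lt_div_iff₀ (by positivity) (by positivity)] at h2

/-- Unit algebra: `2C³(s/κ)¹² < W(s/δ')¹²` ⇒ `2C³δ'¹² < Wκ¹²`. [folklore] -/
theorem law₃_of_scaled {C s κ δ' W : ℝ} (hs : 0 < s) (hκ : 0 < κ) (hδ' : 0 < δ')
    (h : 2 * C ^ 3 * ((s / κ) ^ 4) ^ 3 < W * (s / δ') ^ 12) : 2 * C ^ 3 * δ' ^ 12 < W * κ ^ 12 := by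
  have e1 : 2 * C ^ 3 * ((s / κ) ^ 4) ^ 3 = 2 * C ^ 3 / κ ^ 12 * s ^ 12 := by rw [← pow_mul, div_pow]; ring
  have e2 : W * (s / δ') ^ 12 = W / δ' ^ 12 * s ^ 12 := by rw [div_pow]; ring
  rw [e1, e2] at h
  have h2 := lt_of_mul_lt_mul_right h (by positivity)
  rwa [div_lt_div_iff₀ (by positivity) (by positivity)] at h2

/-- **The AF collar law, one coupling: `2C₁²(2δ)⁸ < W·κ⁸`.**  At coupling `β`, spacing `s > 0`, on a torus `2L+1`: the
registered clause-4 inequality (`ε > 0`, `C₂ ≥ 0`, `κ > 0`) for a witness `v` with time gap `δ > 0`, together with a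
pointwise tolerance `‖y−x‖⁸·|Cov_T(A_x,A_y)| ≤ W` on the pairs charged by `θv, v`, force `2C₁²(2δ)⁸ < W·κ⁸` — no
spacing, no `ε`, no envelope left. [folklore] -/
theorem two_mul_sq_lt_tolerance_of_clause4_at (β : ℝ) {C₁ C₂ s κ W : ℝ} (hC₂ : 0 ≤ C₂) (hκ : 0 < κ) (hs : 0 < s)
    {v : 𝓢(EuclideanSpace ℝ (Fin 4), ℝ)} {δ ε : ℝ} (hε : 0 < ε) (hδ : 0 < δ)
    (hvδ : ∀ y : EuclideanSpace ℝ (Fin 4), v y ≠ 0 → δ ≤ y 0) {L : ℕ}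
    (hW : ∀ x ∈ box 4 L, ∀ y ∈ box 4 L, thetaTest 4 v (s • siteToE x) ≠ 0 → v (s • siteToE y) ≠ 0 →
      ‖siteToE (y - x)‖ ^ 8 * |torusE G r β L (fun U => dens G r x U * dens G r y U) -
        torusE G r β L (dens G r x) * torusE G r β L (dens G r y)| ≤ W)
    (hfloor : ε + 2 * (C₁ * (s / κ) ^ 4 * ∑ x ∈ box 4 L, |thetaTest 4 v (s • siteToE x)|) *
          (C₁ * (s / κ) ^ 4 * ∑ y ∈ box 4 L, |v (s • siteToE y)|) +
        C₂ * (s / κ) ^ 4 * ∑ x ∈ box 4 L, ∑ y ∈ box 4 L,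
          |thetaTest 4 v (s • siteToE x)| * |v (s • siteToE y)| / (1 + ‖siteToE (y - x)‖) ^ 4 ≤
      Q2 G r β L s (thetaTest 4 v) v) :
    2 * C₁ ^ 2 * (2 * δ) ^ 8 < W * κ ^ 8 := by
  have hcap := abs_Q2_le_of_tolerance G r β hs hδ hvδ hW
  have hE2 : 0 ≤ C₂ * (s / κ) ^ 4 * ∑ x ∈ box 4 L, ∑ y ∈ box 4 L,
      |thetaTest 4 v (s • siteToE x)| * |v (s • siteToE y)| / (1 + ‖siteToE (y - x)‖) ^ 4 := by
    refine mul_nonneg (mul_nonneg hC₂ (by positivity)) (Finset.sum_nonneg fun x _ => Finset.sum_nonneg fun y _ => ?_)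
    positivity
  have hkey := two_mul_sq_lt_of_window (C₁ := C₁) (t := (s / κ) ^ 4) hε (Finset.sum_nonneg fun _ _ => abs_nonneg _)
    (Finset.sum_nonneg fun _ _ => abs_nonneg _) (X := Q2 G r β L s (thetaTest 4 v) v) (by linarith)
    ((le_abs_self _).trans hcap)
  exact law₂_of_scaled hs hκ hδ hkey

/-- **The three-point AF collar law, one coupling: `2C₁³δ'¹² < W₃·κ¹²`.**  At coupling `β`, spacing `s > 0`: the registered
clause-5 inequality (`ε > 0`, `C₁, C₂, C₃ ≥ 0`, `κ > 0`) for witnesses `f, g, h` with pairwise support separation `δ' > 0`,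
together with a pointwise three-point tolerance `m¹²·|κ₃,T(x,y,z)| ≤ W₃` on the charged triples (`m` the least pairwise
lattice separation), force `2C₁³δ'¹² < W₃·κ¹²`. [folklore] -/
theorem two_mul_cube_lt_tolerance₃_of_clause5_at (β : ℝ) {C₁ C₂ C₃ s κ W₃ : ℝ} (hC₁ : 0 ≤ C₁) (hC₂ : 0 ≤ C₂)
    (hC₃ : 0 ≤ C₃) (hκ : 0 < κ) (hs : 0 < s) {f g h : 𝓢(EuclideanSpace ℝ (Fin 4), ℝ)} {δ' ε : ℝ} (hε : 0 < ε)
    (hδ' : 0 < δ')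
    (hfg : ∀ p q : EuclideanSpace ℝ (Fin 4), f p ≠ 0 → g q ≠ 0 → δ' ≤ ‖p - q‖)
    (hgh : ∀ p q : EuclideanSpace ℝ (Fin 4), g p ≠ 0 → h q ≠ 0 → δ' ≤ ‖p - q‖)
    (hfh : ∀ p q : EuclideanSpace ℝ (Fin 4), f p ≠ 0 → h q ≠ 0 → δ' ≤ ‖p - q‖) {L : ℕ}
    (hW : ∀ x ∈ box 4 L, ∀ y ∈ box 4 L, ∀ z ∈ box 4 L, f (s • siteToE x) ≠ 0 → g (s • siteToE y) ≠ 0 →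
      h (s • siteToE z) ≠ 0 →
        (min (min ‖siteToE (y - x)‖ ‖siteToE (z - y)‖) ‖siteToE (z - x)‖) ^ 12 * |torusK3 G r β L x y z| ≤ W₃)
    (hfloor : ε + ∑ x ∈ box 4 L, ∑ y ∈ box 4 L, ∑ z ∈ box 4 L,
        |f (s • siteToE x)| * |g (s • siteToE y)| * |h (s • siteToE z)| *
          (2 * ((C₁ * (s / κ) ^ 4) * (C₂ * (s / κ) ^ 4 / (1 + ‖siteToE (z - y)‖) ^ 4) +
                (C₁ * (s / κ) ^ 4) * (C₂ * (s / κ) ^ 4 / (1 + ‖siteToE (z - x)‖) ^ 4) +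
                (C₁ * (s / κ) ^ 4) * (C₂ * (s / κ) ^ 4 / (1 + ‖siteToE (y - x)‖) ^ 4) +
                (C₁ * (s / κ) ^ 4) * (C₁ * (s / κ) ^ 4) * (C₁ * (s / κ) ^ 4)) +
            C₃ * (s / κ) ^ 4 / (1 + min (min ‖siteToE (y - x)‖ ‖siteToE (z - y)‖) ‖siteToE (z - x)‖) ^ 8) ≤
      |Q3 G r β L s f g h|) :
    2 * C₁ ^ 3 * δ' ^ 12 < W₃ * κ ^ 12 := by
  have hcap := abs_Q3_le_of_tolerance₃ G r β hs hδ' hfg hgh hfh hW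
  have ht : 0 ≤ (s / κ) ^ 4 := by positivity
  have hlow := CeilingPrice.tripleSum_kkk_le (box 4 L) (fun x => |f (s • siteToE x)|) (fun y => |g (s • siteToE y)|)
    (fun z => |h (s • siteToE z)|) (fun _ => abs_nonneg _) (fun _ => abs_nonneg _) (fun _ => abs_nonneg _)
    hC₁ hC₂ hC₃ ht (fun x y z => (1 + ‖siteToE (z - y)‖) ^ 4) (fun x y z => (1 + ‖siteToE (z - x)‖) ^ 4)
    (fun x y z => (1 + ‖siteToE (y - x)‖) ^ 4)
    (fun x y z => (1 + min (min ‖siteToE (y - x)‖ ‖siteToE (z - y)‖) ‖siteToE (z - x)‖) ^ 8)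
    (fun _ _ _ => by positivity) (fun _ _ _ => by positivity) (fun _ _ _ => by positivity)
    (fun x y z => pow_nonneg (add_nonneg zero_le_one
      (le_min (le_min (norm_nonneg _) (norm_nonneg _)) (norm_nonneg _))) 8)
  set P := (∑ x ∈ box 4 L, |f (s • siteToE x)|) * (∑ y ∈ box 4 L, |g (s • siteToE y)|) *
    (∑ z ∈ box 4 L, |h (s • siteToE z)|) with hP
  have hP0 : 0 ≤ P := mul_nonneg (mul_nonneg (Finset.sum_nonneg fun _ _ => abs_nonneg _)
    (Finset.sum_nonneg fun _ _ => abs_nonneg _)) (Finset.sum_nonneg fun _ _ => abs_nonneg _)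
  have hfl : ε + 2 * (C₁ * (s / κ) ^ 4) ^ 3 * P ≤ |Q3 G r β L s f g h| := by linarith
  exact law₃_of_scaled hs hκ hδ' (two_mul_cube_lt_of_window (C₁ := C₁) (t := (s / κ) ^ 4) hε hP0 hfl hcap)

end Laws

end Summit.QuantumFields.YangMills.Cruxes.NT.AFCollar

end
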